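import Literature.AnabelianGeometry.SemiGraphs.TemperedGroups
import Mathlib.CategoryTheory.Limits.FullSubcategory
import Mathlib.CategoryTheory.Limits.Shapes.Countable
import Mathlib.CategoryTheory.Limits.Types.Coproducts
import Mathlib.CategoryTheory.Limits.Preserves.Shapes.Products
import Mathlib.CategoryTheory.Action.Limits
import Mathlib.CategoryTheory.Countable
import HarnessLib

/-!
# Semi-graphs of anabelioids, §3: countable coproducts in `B^temp(Π)`

Mochizuki, *Semi-graphs of anabelioids*, Publ. RIMS **42** (2006), §3 Def. 3.1 (iii) and Remark
3.1.5 p. 34 [cite: MochizukiSemiAnbd2006, Rmk 3.1.5 p.34]: morphisms of temperoids preserve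
"countable colimits", and "every temperoid is … of countably connected type" (§0: closed under
countable coproducts; objects are countable coproducts of connected objects; connected objects see
coproducts as disjoint unions of `Hom`-sets).  This proof-only file supplies, for
`B^temp(Π) = BTemp Π` (countable discrete continuous `Π`-sets), the coproduct half of that
structure:

* `BTemp.isClosedUnderColimitsOfShape_discrete` — the defining property `temperedAction Π` is
  closed under countable coproducts in `Action (Type u) Π` (a colimit cofan is jointly surjective on
  points, so the colimit is countable and its stabilisers contain open stabilisers); hence
  `BTemp.hasCountableCoproducts : HasCountableCoproducts (BTemp Π)`;
* `BTemp.cofan_inj_jointly_surjective`, `BTemp.cofan_inj_injective`,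
  `BTemp.cofan_eq_of_inj_apply_eq` — every colimit cofan of `B^temp(Π)` over a countable index type
  is, on underlying sets, the disjoint union of its legs (the inclusion into `Action (Type u) Π`
  followed by the forgetful functor preserves these coproducts).

Proof-only: no definitions.  Consumers: Remark 3.1.5 (countably connected type), Proposition 3.2,
3.6 and Theorem 3.7.
-/

namespace Literature.AnabelianGeometry.SemiGraphs

open CategoryTheory CategoryTheory.Limits Topology

universe u

variable {G : Type u} [Group G] [TopologicalSpace G] [IsTopologicalGroup G]

omit [TopologicalSpace G] [IsTopologicalGroup G] in
/-- Equivariance of a morphism of `Π`-sets, pointwise. [folklore] -/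
private theorem hom_ρ' {X Y : Action (Type u) G} (f : X ⟶ Y) (g : G) (x : X.V) :
    f.hom (X.ρ g x) = Y.ρ g (f.hom x) := by
  have e := ConcreteCategory.congr_hom (f.comm g) x
  simp only [types_comp_apply] at e
  exact e

/-- **Countable coproducts exist in `B^temp(Π)` and are computed in `Π`-sets**: the property
"countable with open stabilisers" is closed under colimits of shape `Discrete J`, `J` countable, in
`Action (Type u) Π`. [cite: MochizukiSemiAnbd2006, Rmk 3.1.5 p.34] -/
theorem BTemp.isClosedUnderColimitsOfShape_discrete (J : Type) [Countable J] :
    ObjectProperty.IsClosedUnderColimitsOfShape (temperedAction G) (Discrete J) := by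
  refine ⟨fun X hX => ?_⟩
  obtain ⟨p⟩ := hX
  have hc := isColimitOfPreserves (Action.forget (Type u) G) p.isColimit
  -- jointly surjective on points
  have hsurj : ∀ x : X.V, ∃ (j : Discrete J) (y : (p.diag.obj j).V), (p.ι.app j).hom y = x := by
    intro x
    obtain ⟨j, y, hy⟩ := Types.jointly_surjective_of_isColimit hc x
    exact ⟨j, y, hy⟩
  refine ⟨?_, fun x => ?_⟩
  · -- countable
    haveI : ∀ j : Discrete J, Countable (p.diag.obj j).V := fun j => (p.prop_diag_obj j).1
    have hf : Function.Surjective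
        (fun q : (Σ j : Discrete J, (p.diag.obj j).V) => (show X.V from (p.ι.app q.1).hom q.2)) := by
      intro x
      obtain ⟨j, y, hy⟩ := hsurj x
      exact ⟨⟨j, y⟩, hy⟩
    exact hf.countable
  · -- open stabilisers
    obtain ⟨j, y, rfl⟩ := hsurj x
    letI i₁ : MulAction G (p.diag.obj j).V := Action.instMulAction (p.diag.obj j)
    letI i₂ : MulAction G X.V := Action.instMulAction X
    let x' : X.V := (p.ι.app j).hom y
    have hle : MulAction.stabilizer G y ≤ MulAction.stabilizer G x' := by
      intro g hg
      rw [MulAction.mem_stabilizer_iff] at hg ⊢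
      exact ((hom_ρ' (p.ι.app j) g y).symm.trans
        (congrArg (fun z => (show X.V from (p.ι.app j).hom z)) hg))
    have hopen : IsOpen (MulAction.stabilizer G x' : Set G) :=
      Subgroup.isOpen_mono hle ((p.prop_diag_obj j).2 y)
    exact hopen

/-- **`B^temp(Π)` has countable coproducts** ([SemiAnbd] Def. 3.1 (iii) / Rmk 3.1.5: temperoids
are closed under countable coproducts). [cite: MochizukiSemiAnbd2006, Rmk 3.1.5 p.34] -/
theorem BTemp.hasCountableCoproducts : HasCountableCoproducts (BTemp G) :=
  ⟨fun J _ => by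
    haveI := BTemp.isClosedUnderColimitsOfShape_discrete (G := G) J
    exact hasColimitsOfShape_of_closedUnderColimits (Discrete J) (temperedAction G)⟩

/-- The forgetful functor `B^temp(Π) ⥤ Type` preserves countable coproducts. [folklore] -/
private theorem preservesColimitsOfShape_forget (J : Type) [Countable J] :
    PreservesColimitsOfShape (Discrete J) ((temperedAction G).ι ⋙ Action.forget (Type u) G) := by
  haveI := BTemp.isClosedUnderColimitsOfShape_discrete (G := G) J
  infer_instance

/-- **Colimit cofans of `B^temp(Π)` are disjoint unions, I**: the legs of a colimit cofan over a
countable index type are jointly surjective on points. [cite: MochizukiSemiAnbd2006, Rmk 3.1.5 p.34] -/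
theorem BTemp.cofan_inj_jointly_surjective {J : Type} [Countable J] {X : J → BTemp G} {P : BTemp G}
    (g : ∀ j, X j ⟶ P) (hc : IsColimit (Cofan.mk P g)) (x : P.obj.V) :
    ∃ (j : J) (y : (X j).obj.V), (g j).hom.hom y = x := by
  haveI := preservesColimitsOfShape_forget (G := G) J
  have hc' := isColimitCofanMkObjOfIsColimit ((temperedAction G).ι ⋙ Action.forget (Type u) G) X g hc
  obtain ⟨j, y, hy⟩ := Cofan.inj_jointly_surjective_of_isColimit hc' x
  exact ⟨j, y, hy⟩

/-- **Colimit cofans of `B^temp(Π)` are disjoint unions, II**: each leg of a colimit cofan over a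
countable index type is injective on points. [cite: MochizukiSemiAnbd2006, Rmk 3.1.5 p.34] -/
theorem BTemp.cofan_inj_injective {J : Type} [Countable J] {X : J → BTemp G} {P : BTemp G}
    (g : ∀ j, X j ⟶ P) (hc : IsColimit (Cofan.mk P g)) (j : J) :
    Function.Injective fun y : (X j).obj.V => ((g j).hom.hom y : P.obj.V) := by
  haveI := preservesColimitsOfShape_forget (G := G) J
  have hc' := isColimitCofanMkObjOfIsColimit ((temperedAction G).ι ⋙ Action.forget (Type u) G) X g hc
  exact Cofan.inj_injective_of_isColimit hc' j

/-- **Colimit cofans of `B^temp(Π)` are disjoint unions, III**: distinct legs of a colimit cofan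
over a countable index type have disjoint images. [cite: MochizukiSemiAnbd2006, Rmk 3.1.5 p.34] -/
theorem BTemp.cofan_eq_of_inj_apply_eq {J : Type} [Countable J] {X : J → BTemp G} {P : BTemp G}
    (g : ∀ j, X j ⟶ P) (hc : IsColimit (Cofan.mk P g)) {i j : J} (y : (X i).obj.V)
    (y' : (X j).obj.V) (h : ((g i).hom.hom y : P.obj.V) = (g j).hom.hom y') : i = j := by
  haveI := preservesColimitsOfShape_forget (G := G) J
  have hc' := isColimitCofanMkObjOfIsColimit ((temperedAction G).ι ⋙ Action.forget (Type u) G) X g hc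
  exact Cofan.eq_of_inj_apply_eq_of_isColimit hc' y y' h

end Literature.AnabelianGeometry.SemiGraphs
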